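import Literature.Probability.LatticeModels.ButterflyLemma
import Literature.Probability.LatticeModels.StarZhangCrossing
import Literature.Probability.LatticeModels.StarBurtonKeane
import Literature.Probability.LatticeModels.SpinPercolationDichotomy
import Literature.Probability.LatticeModels.IsingTranslationInvariance
import HarnessLib

/-!
# The plus-sea lemma: no infinite `-∗`cluster in the plus phase (Georgii–Higuchi 2000, Cor. 3.3)

Topic `Probability/LatticeModels`. Georgii–Higuchi, J. Math. Phys. 41 (2000), Corollary 3.3
(Plus-sea in the plus-phase): "`μ⁺(E⁻∗) = 0`. Hence, `μ⁺`-almost surely there exists a unique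
infinite `+`cluster `I⁺` in `ℤ²` which surrounds each finite set." We prove the first statement,
**`measure_existsInfCluster_star_neg_eq_zero_of_spinCorr_eq_plusCorr`**: for `β > β_c(2)` and any
`μ⁺ ∈ 𝒢(β, 0)` with the plus correlations, `μ⁺`-almost surely there is no infinite `∗`-cluster of
`-`spins.

GH derive this from the proof of Cor. 3.2 (Poincaré recurrence, Burton–Keane, and a separation
argument), noting that "in contrast to Zhang's argument … our proof … does not rely on the reflection
invariance of `μ⁺` but only on its periodicity". Here we give **Zhang's argument** (the one GH
allude to, cf. [7], Thm. 5.18), for which all ingredients are in the tree: `μ⁺` is invariant under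
the reflections `R_hor`, `R_vert` and all translations, tail trivial, and has positive correlations
and finite energy; by Burton–Keane (`IsingClusterUniqueness`, `StarBurtonKeane`) the infinite
`+`cluster and — if it existed — the infinite `-∗`cluster are unique; as in the proof of the
butterfly lemma (`ButterflyLemma.lean`), positive correlations and the reflection symmetries give,
with probability `> 1/2`, `+`paths inside a square `Λ_N` to all four closed-quadrant arcs of `∂Λ_N`
from sites of `Λ_m` in the infinite `+`cluster, and `-∗`paths to all four arcs from sites in the
infinite `-∗`cluster, together with local uniqueness for both; whence a `+`path in `Λ_N` joining
`∂₁Λ_N` to `∂₃Λ_N` and a `-∗`path joining `∂₂Λ_N` to `∂₄Λ_N`, which is impossible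
(`StarZhangCrossing`).

## References

* H.-O. Georgii, Y. Higuchi, J. Math. Phys. 41 (2000), Cor. 3.3 and the remark following it
  (p. 8); proof of Lemma 3.1, Step 2 [GeorgiiHiguchi2000].
* H.-O. Georgii, O. Häggström, C. Maes, *The random geometry of equilibrium phases*, Thm. 5.18
  (Zhang's argument), as cited in [GeorgiiHiguchi2000].
-/

noncomputable section

open MeasureTheory Filter Topology Finset SimpleGraph
open Literature.Probability.Percolation (siteCluster siteOpenGraph siteOpenGraph_adj siteOpenGraph_mono
  sitePercolatesAt withinGraph withinGraph_adj exists_adj_reachable_withinGraph_of_walk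
  siteCluster_relabel stepKind_of_adj)
open scoped ENNReal

namespace Literature.Probability.LatticeModels

/-! ### Arm events for a general graph on `ℤ²` -/

section Events

variable (G : SimpleGraph (Site 2))

/-- `x` and `e` are joined by a `G`-path of `s`-sites inside `Λ_N`. [cite: GeorgiiHiguchi2000, Lemma 3.1 (proof, Step 2, p. 7)] -/
def boxConnOf (s : ℤˣ) (N : ℕ) (ω : SpinConfig (Site 2)) (x e : Site 2) : Prop :=
  (siteOpenGraph G (spinSites s ω ∩ ↑(box 2 N))).Reachable x e

/-- The arm event for `G`-clusters: some site of `Λ_m` with an infinite `s`-cluster of `G` is joined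
by a `G`-path of `s`-sites inside `Λ_N` to `T`. [cite: GeorgiiHiguchi2000, Lemma 3.1 (proof, Step 2, p. 7)] -/
def armEventOf (s : ℤˣ) (m N : ℕ) (T : Set (Site 2)) : Set (SpinConfig (Site 2)) :=
  {ω | ∃ x ∈ box 2 m, (siteCluster G (spinSites s ω) x).Infinite ∧ ∃ e ∈ T, boxConnOf G s N ω x e}

/-- Local uniqueness for `G`-clusters inside `Λ_N`. [cite: GeorgiiHiguchi2000, Lemma 3.1 (proof, Step 2, p. 7)] -/
def localUniqueOf (s : ℤˣ) (m N : ℕ) : Set (SpinConfig (Site 2)) :=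
  {ω | ∀ x ∈ box 2 m, ∀ y ∈ box 2 m, (siteCluster G (spinSites s ω) x).Infinite →
    (siteCluster G (spinSites s ω) y).Infinite → boxConnOf G s N ω x y}

variable {G}

/-- `{C^s_G(x) infinite}` is measurable. [folklore] -/
theorem measurableSet_infinite_siteClusterOf [G.LocallyFinite] (s : ℤˣ) (x : Site 2) :
    MeasurableSet {ω : SpinConfig (Site 2) | (siteCluster G (spinSites s ω) x).Infinite} :=
  measurable_spinSites s (measurableSet_sitePercolatesAt (G := G) x)

/-- `boxConnOf` depends only on the spins in `Λ_N`, hence is measurable. [folklore] -/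
theorem measurableSet_boxConnOf (s : ℤˣ) (N : ℕ) (x e : Site 2) :
    MeasurableSet {ω : SpinConfig (Site 2) | boxConnOf G s N ω x e} := by
  refine cylinderEvents_le_pi _ (measurableSet_cylinderEvents_of_forall_eq (K := box 2 N) ?_)
  intro ω ω' h
  have hO : spinSites s ω ∩ ↑(box 2 N) = spinSites s ω' ∩ ↑(box 2 N) := by
    ext z
    simp only [Set.mem_inter_iff, mem_spinSites, Finset.mem_coe]
    constructor
    · rintro ⟨hz, hzB⟩; exact ⟨by rw [← h z hzB]; exact hz, hzB⟩
    · rintro ⟨hz, hzB⟩; exact ⟨by rw [h z hzB]; exact hz, hzB⟩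
  simp only [Set.mem_setOf_eq, boxConnOf, hO]

/-- Arm events are measurable. [folklore] -/
theorem measurableSet_armEventOf [G.LocallyFinite] (s : ℤˣ) (m N : ℕ) (T : Set (Site 2)) :
    MeasurableSet (armEventOf G s m N T) := by
  have h : armEventOf G s m N T = ⋃ x ∈ box 2 m, ({ω | (siteCluster G (spinSites s ω) x).Infinite} ∩
      ⋃ e ∈ T, {ω | boxConnOf G s N ω x e}) := by
    ext ω; simp only [armEventOf, Set.mem_setOf_eq, Set.mem_iUnion, Set.mem_inter_iff, exists_prop]
  rw [h]
  exact MeasurableSet.biUnion (Set.to_countable _) fun x _ =>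
    (measurableSet_infinite_siteClusterOf s x).inter
      (MeasurableSet.biUnion (Set.to_countable _) fun e _ => measurableSet_boxConnOf s N x e)

/-- Local uniqueness events are measurable. [folklore] -/
theorem measurableSet_localUniqueOf [G.LocallyFinite] (s : ℤˣ) (m N : ℕ) : MeasurableSet (localUniqueOf G s m N) := by
  have h : localUniqueOf G s m N = ⋂ x ∈ box 2 m, ⋂ y ∈ box 2 m,
      ({ω | (siteCluster G (spinSites s ω) x).Infinite}ᶜ ∪
        ({ω | (siteCluster G (spinSites s ω) y).Infinite}ᶜ ∪ {ω | boxConnOf G s N ω x y})) := by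
    ext ω
    simp only [localUniqueOf, Set.mem_setOf_eq, Set.mem_iInter, Set.mem_union, Set.mem_compl_iff]
    constructor
    · intro h x hx y hy
      by_cases h1 : (siteCluster G (spinSites s ω) x).Infinite
      · by_cases h2 : (siteCluster G (spinSites s ω) y).Infinite
        · exact Or.inr (Or.inr (h x hx y hy h1 h2))
        · exact Or.inr (Or.inl h2)
      · exact Or.inl h1
    · intro h x hx y hy h1 h2
      rcases h x hx y hy with h' | h' | h'
      · exact absurd h1 h'
      · exact absurd h2 h'
      · exact h'
  rw [h]
  exact MeasurableSet.biInter (Set.to_countable _) fun x _ => MeasurableSet.biInter (Set.to_countable _)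
    fun y _ => (measurableSet_infinite_siteClusterOf s x).compl.union
      ((measurableSet_infinite_siteClusterOf s y).compl.union (measurableSet_boxConnOf s N x y))

/-- `+`arm events are increasing. [folklore] -/
theorem isUpperSet_armEventOf_one (m N : ℕ) (T : Set (Site 2)) : IsUpperSet (armEventOf G 1 m N T) := by
  intro ω ω' hle hω
  obtain ⟨x, hx, hinf, e, he, hconn⟩ := hω
  have hsub : spinSites 1 ω ⊆ spinSites 1 ω' := spinSites_one_mono hle
  refine ⟨x, hx, hinf.mono (siteCluster_mono hsub x), e, he, ?_⟩
  exact hconn.mono (siteOpenGraph_mono _ (Set.inter_subset_inter_left _ hsub))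

/-- `-`sites decrease with the configuration. [folklore] -/
theorem spinSites_neg_one_anti {ω ω' : SpinConfig (Site 2)} (h : ω ≤ ω') :
    spinSites (-1) ω' ⊆ spinSites (-1) ω := by
  intro x hx
  rw [mem_spinSites] at hx ⊢
  have h1 : ω x ≤ ω' x := h x
  rw [hx] at h1
  rcases Int.units_eq_one_or (ω x) with h2 | h2
  · rw [h2] at h1; exact absurd h1 (by decide)
  · exact h2

/-- `-`arm events are decreasing. [folklore] -/
theorem isLowerSet_armEventOf_neg_one (m N : ℕ) (T : Set (Site 2)) : IsLowerSet (armEventOf G (-1) m N T) := by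
  intro ω ω' hle hω
  obtain ⟨x, hx, hinf, e, he, hconn⟩ := hω
  have hsub : spinSites (-1) ω ⊆ spinSites (-1) ω' := spinSites_neg_one_anti hle
  refine ⟨x, hx, hinf.mono (siteCluster_mono hsub x), e, he, ?_⟩
  exact hconn.mono (siteOpenGraph_mono _ (Set.inter_subset_inter_left _ hsub))

/-- `boxConnOf` is monotone in the box. [folklore] -/
theorem boxConnOf_mono {s : ℤˣ} {N N' : ℕ} (h : N ≤ N') {ω : SpinConfig (Site 2)} {x e : Site 2}
    (hc : boxConnOf G s N ω x e) : boxConnOf G s N' ω x e :=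
  hc.mono (siteOpenGraph_mono _ (Set.inter_subset_inter_right _
    (Finset.coe_subset.2 (box_mono 2 h))))

/-- The end of a box connection from an `s`-site of `Λ_N` is an `s`-site of `Λ_N`. [folklore] -/
theorem mem_of_boxConnOf {s : ℤˣ} {N : ℕ} {ω : SpinConfig (Site 2)} {x e : Site 2}
    (hc : boxConnOf G s N ω x e) (hx : x ∈ spinSites s ω ∩ ↑(box 2 N)) : e ∈ spinSites s ω ∩ ↑(box 2 N) := by
  obtain ⟨p⟩ := hc
  exact support_subset_of_walk_siteOpenGraph p hx e (Walk.end_mem_support p)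

/-- A site with an infinite `s`-cluster is an `s`-site. [folklore] -/
theorem mem_spinSites_of_infiniteOf {s : ℤˣ} {ω : SpinConfig (Site 2)} {x : Site 2}
    (h : (siteCluster G (spinSites s ω) x).Infinite) : x ∈ spinSites s ω := by
  obtain ⟨y, hy⟩ := h.nonempty
  exact hy.1

/-- Arm events are monotone in the target set. [folklore] -/
theorem armEventOf_mono {s : ℤˣ} {m N : ℕ} {T T' : Set (Site 2)} (h : T ⊆ T') :
    armEventOf G s m N T ⊆ armEventOf G s m N T' := fun _ ⟨x, hx, hinf, e, he, hc⟩ =>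
  ⟨x, hx, hinf, e, h he, hc⟩

/-! ### Covering for range-one graphs -/

/-- A site of `Λ_N` at sup-distance `≤ 1` from a site outside `Λ_N` lies on a quadrant arc. [folklore] -/
theorem exists_quadArc_of_range_one {N : ℕ} {a b : Site 2} (ha : a ∈ box 2 N) (hb : b ∉ box 2 N)
    (hab : ∀ i, |a i - b i| ≤ 1) : ∃ q : ℤˣ × ℤˣ, a ∈ quadArc q N := by
  rw [mem_box] at ha hb
  push Not at hb
  obtain ⟨i, hi⟩ := hb
  have ha0 := ha 0; have ha1 := ha 1
  have hsgn : ∀ t : ℤ, ∃ u : ℤˣ, 0 ≤ (u : ℤ) * t := fun t => by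
    rcases le_or_gt 0 t with ht | ht
    · exact ⟨1, by simpa using ht⟩
    · exact ⟨-1, by simp; omega⟩
  have h0 := hab 0; have h1 := hab 1
  rw [abs_le] at h0 h1
  fin_cases i <;> simp at hi
  · -- `b 0` out of range, so `a 0 = ±N`
    by_cases hcase : a 0 = N
    · obtain ⟨u, hu⟩ := hsgn (a 1)
      exact ⟨(1, u), Or.inl ⟨by simpa using hcase, hu⟩⟩
    · have : a 0 = -N := by omega
      obtain ⟨u, hu⟩ := hsgn (a 1)
      exact ⟨(-1, u), Or.inl ⟨by simp; omega, hu⟩⟩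
  · by_cases hcase : a 1 = N
    · obtain ⟨u, hu⟩ := hsgn (a 0)
      exact ⟨(u, 1), Or.inr ⟨by simpa using hcase, hu⟩⟩
    · have : a 1 = -N := by omega
      obtain ⟨u, hu⟩ := hsgn (a 0)
      exact ⟨(u, -1), Or.inr ⟨by simp; omega, hu⟩⟩

/-- **Covering** for a range-one graph: an infinite `s`-cluster of `G` meeting `Λ_m` reaches some
quadrant arc of `∂Λ_N`, `N ≥ m`, inside `Λ_N`. [cite: GeorgiiHiguchi2000, Lemma 3.1 (proof, Step 2, p. 7)] -/
theorem subset_iUnion_armEventOf (hsup : ∀ x y, G.Adj x y → ∀ i, |x i - y i| ≤ 1) (s : ℤˣ)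
    {m N : ℕ} (hmN : m ≤ N) :
    {ω : SpinConfig (Site 2) | ∃ x ∈ box 2 m, (siteCluster G (spinSites s ω) x).Infinite} ⊆
      ⋃ q : ℤˣ × ℤˣ, armEventOf G s m N (quadArc q N) := by
  rintro ω ⟨x, hx, hinf⟩
  have hxN : x ∈ box 2 N := box_mono 2 hmN hx
  obtain ⟨y, hy, hyN⟩ : ∃ y ∈ siteCluster G (spinSites s ω) x, y ∉ box 2 N := by
    by_contra h
    push Not at h
    exact hinf ((box 2 N).finite_toSet.subset fun y hy => h y hy)
  obtain ⟨-, -, hr⟩ := hy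
  obtain ⟨p⟩ := hr
  obtain ⟨a, b, ha, hb, hab, -, hreach⟩ := exists_adj_reachable_withinGraph_of_walk
    (siteOpenGraph G (spinSites s ω)) p (S := (↑(box 2 N) : Set (Site 2))) hxN
    ⟨y, Walk.end_mem_support p, hyN⟩
  have hab' := (siteOpenGraph_adj _ _ _ _).1 hab
  obtain ⟨q, hq⟩ := exists_quadArc_of_range_one ha hb (hsup a b hab'.1)
  refine Set.mem_iUnion.2 ⟨q, x, hx, hinf, a, hq, ?_⟩
  change (siteOpenGraph G (spinSites s ω ∩ ↑(box 2 N))).Reachable x a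
  rwa [withinGraph_siteOpenGraph] at hreach

/-! ### Transport under reflections (no spin flip) -/

/-- **Reflections transport arm events** (for a reflection-covariant `G`):
`R⁻¹(A^s_G(T)) ⊆ A^s_G(R(T))`. [cite: GeorgiiHiguchi2000, §2 p. 3] -/
theorem preimage_configRelabel_armEventOf_subset (i : Fin 2)
    (hG : ∀ a b, G.Adj a b → G.Adj (reflectCoord i a) (reflectCoord i b)) (s : ℤˣ) (m N : ℕ)
    (T : Set (Site 2)) :
    configRelabel (reflectCoord i).toEquiv ⁻¹' armEventOf G s m N T ⊆ armEventOf G s m N (reflectCoord i '' T) := by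
  intro ω hω
  set R := reflectCoord (d := 2) i with hR
  have hRR : ∀ z, R (R z) = z := reflectCoord_reflectCoord i
  have hS : spinSites s (configRelabel R.toEquiv ω) = R.toEquiv '' spinSites s ω := spinSites_configRelabel _ _ _
  obtain ⟨x, hx, hinf, e, he, hconn⟩ := hω
  rw [hS] at hinf
  have hconn' : (siteOpenGraph G (R.toEquiv '' spinSites s ω ∩ ↑(box 2 N))).Reachable x e := by
    unfold boxConnOf at hconn; rwa [hS] at hconn
  -- the `R`-image of an `s`-cluster, via the graph hom induced by `R`
  let ψ : ∀ O : Set (Site 2), siteOpenGraph G (R.toEquiv '' O) →g siteOpenGraph G O := fun O =>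
    { toFun := R
      map_rel' := fun {a b} hab => by
        rw [siteOpenGraph_adj] at hab ⊢
        obtain ⟨hGab, ⟨a', ha', haa⟩, ⟨b', hb', hbb⟩⟩ := hab
        refine ⟨hG a b hGab, ?_, ?_⟩
        · change R.toEquiv a' = a at haa
          rw [← haa]; change R (R a') ∈ O; rwa [hRR]
        · change R.toEquiv b' = b at hbb
          rw [← hbb]; change R (R b') ∈ O; rwa [hRR] }
  refine ⟨R x, (reflectCoord_mem_box_iff i m x).2 hx, ?_, R e, Set.mem_image_of_mem _ he, ?_⟩
  · -- the cluster of `R x` contains the `R`-image of the cluster of `x`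
    have hsub : R '' siteCluster G (R.toEquiv '' spinSites s ω) x ⊆ siteCluster G (spinSites s ω) (R x) := by
      rintro _ ⟨w, ⟨hxO, hwO, hr⟩, rfl⟩
      obtain ⟨x', hx', hxx⟩ := hxO
      obtain ⟨w', hw', hww⟩ := hwO
      refine ⟨?_, ?_, hr.map (ψ _)⟩
      · change R.toEquiv x' = x at hxx
        rw [← hxx]; change R (R x') ∈ _; rwa [hRR]
      · change R.toEquiv w' = w at hww
        rw [← hww]; change R (R w') ∈ _; rwa [hRR]
    exact (hinf.image R.injective.injOn).mono hsub
  · have himg : R.toEquiv '' spinSites s ω ∩ ↑(box 2 N) = R.toEquiv '' (spinSites s ω ∩ ↑(box 2 N)) := by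
      ext z
      simp only [Set.mem_inter_iff, Set.mem_image, Finset.mem_coe]
      constructor
      · rintro ⟨⟨w, hw, rfl⟩, hzB⟩
        exact ⟨w, ⟨hw, (reflectCoord_mem_box_iff i N w).1 hzB⟩, rfl⟩
      · rintro ⟨w, ⟨hw, hwB⟩, rfl⟩
        exact ⟨⟨w, hw, rfl⟩, (reflectCoord_mem_box_iff i N w).2 hwB⟩
    rw [himg] at hconn'
    exact hconn'.map (ψ _)

end Events

/-! ### Positive correlations for increasing events -/

section FKG

variable {d : ℕ} {β h : ℝ} {μ : Measure (SpinConfig (Site d))}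

/-- **FKG for finitely many increasing events**: `∏ μ(U_i) ≤ μ(⋂ U_i)` (from the lower-set version
applied to the configuration-reversed events is not available; proved directly from
`isingGibbs_integral_mul_ge_of_isTailTrivial` with the monotone indicators). [cite: GeorgiiHiguchi2000, §2 p. 3] -/
theorem prod_measureReal_le_measureReal_iInter_of_isUpperSet {ι : Type*} (hβ : 0 ≤ β)
    (hμ : μ ∈ isingGibbsMeasures d β h) (hμt : IsTailTrivial μ) (t : Finset ι)
    {U : ι → Set (SpinConfig (Site d))} (hU : ∀ i, IsUpperSet (U i)) (hUm : ∀ i, MeasurableSet (U i)) :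
    ∏ i ∈ t, μ.real (U i) ≤ μ.real (⋂ i ∈ t, U i) := by
  classical
  have hμG : IsGibbsMeasure (isingSpecification (zdGraph d) β h) μ := hμ
  haveI := hμG.isProbabilityMeasure
  -- pairwise version
  have pair : ∀ {D E : Set (SpinConfig (Site d))}, IsUpperSet D → IsUpperSet E → MeasurableSet D →
      MeasurableSet E → μ.real D * μ.real E ≤ μ.real (D ∩ E) := by
    intro D E hD hE hDm hEm
    have hmono : ∀ {A : Set (SpinConfig (Site d))}, IsUpperSet A →
        Monotone fun σ : SpinConfig (Site d) => A.indicator (1 : SpinConfig (Site d) → ℝ) σ := by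
      intro A hA σ τ hστ
      show A.indicator (1 : SpinConfig (Site d) → ℝ) σ ≤ A.indicator 1 τ
      by_cases hσ : σ ∈ A
      · rw [Set.indicator_of_mem hσ, Set.indicator_of_mem (hA hστ hσ)]
        exact le_rfl
      · rw [Set.indicator_of_notMem hσ]
        by_cases hτ : τ ∈ A
        · rw [Set.indicator_of_mem hτ]; simp
        · rw [Set.indicator_of_notMem hτ]
    have hbd : ∀ {A : Set (SpinConfig (Site d))} (σ : SpinConfig (Site d)),
        |A.indicator (1 : SpinConfig (Site d) → ℝ) σ| ≤ 1 := by
      intro A σ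
      by_cases hσ : σ ∈ A
      · rw [Set.indicator_of_mem hσ]; simp
      · rw [Set.indicator_of_notMem hσ]; simp
    have key := isingGibbs_integral_mul_ge_of_isTailTrivial hβ hμ hμt (hmono hD) (hmono hE)
      (measurable_const.indicator hDm) (measurable_const.indicator hEm) hbd hbd
    rw [integral_indicator_one hDm, integral_indicator_one hEm] at key
    have h3 : ∫ σ, D.indicator (1 : SpinConfig (Site d) → ℝ) σ * E.indicator 1 σ ∂μ = μ.real (D ∩ E) := by
      rw [← integral_indicator_one (hDm.inter hEm)]
      refine integral_congr_ae (Eventually.of_forall fun σ => ?_)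
      rw [Set.inter_indicator_one]
      rfl
    rwa [h3] at key
  induction t using Finset.induction_on with
  | empty => simp
  | insert a t hat ih =>
    rw [Finset.prod_insert hat]
    have hset : (⋂ i ∈ insert a t, U i) = U a ∩ ⋂ i ∈ t, U i := by
      ext ω; simp
    rw [hset]
    have hup : IsUpperSet (⋂ i ∈ t, U i) := isUpperSet_iInter₂ fun i _ => hU i
    have hmeas : MeasurableSet (⋂ i ∈ t, U i) := Finset.measurableSet_biInter t fun i _ => hUm i
    calc μ.real (U a) * ∏ i ∈ t, μ.real (U i) ≤ μ.real (U a) * μ.real (⋂ i ∈ t, U i) :=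
          mul_le_mul_of_nonneg_left ih measureReal_nonneg
      _ ≤ μ.real (U a ∩ ⋂ i ∈ t, U i) := pair (hU a) hup (hUm a) hmeas

end FKG

/-! ### Limits: boxes meeting infinite clusters, local uniqueness -/

section Limits

variable {G : SimpleGraph (Site 2)} {μ : Measure (SpinConfig (Site 2))}

/-- From `E^s_G` almost surely: some `Λ_m` meets an infinite `s`-cluster with probability `> 1 - ε`. [folklore] -/
theorem exists_box_meets_infiniteOf (s : ℤˣ) [IsProbabilityMeasure μ]
    (hE : μ (existsInfCluster G s) = 1) {ε : ℝ} (hε : 0 < ε) :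
    ∀ᶠ m : ℕ in atTop, 1 - ε < μ.real {ω : SpinConfig (Site 2) |
      ∃ x ∈ box 2 m, (siteCluster G (spinSites s ω) x).Infinite} := by
  set F : ℕ → Set (SpinConfig (Site 2)) := fun m =>
    {ω | ∃ x ∈ box 2 m, (siteCluster G (spinSites s ω) x).Infinite} with hF
  have hmono : Monotone F := fun m n hmn ω ⟨x, hx, h⟩ => ⟨x, box_mono 2 hmn hx, h⟩
  have hU : (⋃ m, F m) = existsInfCluster G s := by
    ext ω
    simp only [Set.mem_iUnion, hF, Set.mem_setOf_eq, mem_existsInfCluster_iff]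
    constructor
    · rintro ⟨m, x, -, hx⟩; exact ⟨x, hx⟩
    · rintro ⟨x, hx⟩
      obtain ⟨m, hm⟩ := (eventually_subset_box_holds (d := 2) {x}).exists
      exact ⟨m, x, hm (Finset.mem_singleton_self x), hx⟩
  have ht := tendsto_measure_iUnion_atTop (μ := μ) hmono
  rw [hU, hE] at ht
  have ht' : Tendsto (fun m => μ.real (F m)) atTop (𝓝 1) := by
    have := (ENNReal.tendsto_toReal ENNReal.one_ne_top).comp ht
    simpa [measureReal_def, Function.comp_def] using this
  exact (tendsto_order.1 ht').1 _ (by linarith)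

/-- From a.s. uniqueness of the infinite `s`-cluster of `G`: local uniqueness in `Λ_N` with probability
`> 1 - ε` for `N` large. [folklore] -/
theorem eventually_measureReal_localUniqueOf [G.LocallyFinite] (s : ℤˣ) [IsProbabilityMeasure μ] (m : ℕ)
    (huniq : ∀ᵐ ω ∂μ, ∀ x y, (siteCluster G (spinSites s ω) x).Infinite →
      (siteCluster G (spinSites s ω) y).Infinite → (siteOpenGraph G (spinSites s ω)).Reachable x y)
    {ε : ℝ} (hε : 0 < ε) :
    ∀ᶠ N : ℕ in atTop, 1 - ε < μ.real (localUniqueOf G s m N) := by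
  have hmono : Monotone (localUniqueOf G s m) := fun N N' hNN' ω hω x hx y hy h1 h2 =>
    boxConnOf_mono hNN' (hω x hx y hy h1 h2)
  have hcov : {ω | ∀ x y, (siteCluster G (spinSites s ω) x).Infinite →
      (siteCluster G (spinSites s ω) y).Infinite →
        (siteOpenGraph G (spinSites s ω)).Reachable x y} ⊆ ⋃ N, localUniqueOf G s m N := by
    intro ω hω
    have hev : ∀ x ∈ box 2 m, ∀ y ∈ box 2 m, ∀ᶠ N : ℕ in atTop,
        (siteCluster G (spinSites s ω) x).Infinite →
          (siteCluster G (spinSites s ω) y).Infinite → boxConnOf G s N ω x y := by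
      intro x _ y _
      by_cases h1 : (siteCluster G (spinSites s ω) x).Infinite
      · by_cases h2 : (siteCluster G (spinSites s ω) y).Infinite
        · obtain ⟨p⟩ := hω x y h1 h2
          have hx : x ∈ spinSites s ω := mem_spinSites_of_infiniteOf h1
          obtain ⟨N₀, hN₀⟩ := (eventually_subset_box_holds (d := 2) p.support.toFinset).exists_forall_of_atTop
          refine eventually_atTop.2 ⟨N₀, fun N hN _ _ => ?_⟩
          have hsupp : ∀ z ∈ p.support, z ∈ spinSites s ω ∩ ↑(box 2 N) := fun z hz =>
            ⟨support_subset_of_walk_siteOpenGraph p hx z hz,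
              Finset.mem_coe.2 (hN₀ N hN (List.mem_toFinset.2 hz))⟩
          exact siteOpenGraph_reachable_of_walk (p.mapLe (by
            intro a b hab; exact ((siteOpenGraph_adj _ _ _ _).1 hab).1)) (by
            intro z hz; rw [Walk.support_mapLe_eq_support] at hz; exact hsupp z hz)
        · exact Eventually.of_forall fun N _ h => absurd h h2
      · exact Eventually.of_forall fun N h _ => absurd h h1
    have hev' : ∀ᶠ N : ℕ in atTop, ∀ x ∈ box 2 m, ∀ y ∈ box 2 m,
        (siteCluster G (spinSites s ω) x).Infinite →
          (siteCluster G (spinSites s ω) y).Infinite → boxConnOf G s N ω x y := by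
      rw [eventually_all_finset]
      intro x hx
      rw [eventually_all_finset]
      exact hev x hx
    obtain ⟨N, hN⟩ := hev'.exists
    exact Set.mem_iUnion.2 ⟨N, hN⟩
  have h0 : μ (⋃ N, localUniqueOf G s m N)ᶜ = 0 := by
    have hsub : (⋃ N, localUniqueOf G s m N)ᶜ ⊆ {ω | ¬ ∀ x y,
        (siteCluster G (spinSites s ω) x).Infinite →
          (siteCluster G (spinSites s ω) y).Infinite →
            (siteOpenGraph G (spinSites s ω)).Reachable x y} :=
      fun ω hω hω' => hω (hcov hω')
    exact measure_mono_null hsub (ae_iff.1 huniq)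
  have h1 : μ (⋃ N, localUniqueOf G s m N) = 1 :=
    (prob_compl_eq_zero_iff (MeasurableSet.iUnion fun N => measurableSet_localUniqueOf s m N)).1 h0
  have ht := tendsto_measure_iUnion_atTop (μ := μ) hmono
  rw [h1] at ht
  have ht' : Tendsto (fun N => μ.real (localUniqueOf G s m N)) atTop (𝓝 1) := by
    have := (ENNReal.tendsto_toReal ENNReal.one_ne_top).comp ht
    simpa [measureReal_def, Function.comp_def] using this
  exact (tendsto_order.1 ht').1 _ (by linarith)

end Limits

/-! ### The plus state: symmetries and uniqueness of the `∗`-clusters -/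

section PlusState

variable {β : ℝ} {μp : Measure (SpinConfig (Site 2))}

/-- `(Site.shift v)⁻¹ = Site.shift (-v)`. [folklore] -/
theorem shift_symm_eq_shift_neg (v : Site 2) : (Site.shift v).symm = Site.shift (-v) := by
  ext x i
  simp [sub_eq_add_neg]

/-- **The plus state is translation invariant** (Georgii–Higuchi 2000, §2 p. 3: invariance of the
pure phases under all graph automorphisms; from the tree's `plusCorr_shift`). [cite: GeorgiiHiguchi2000, §2 p. 3] -/
theorem map_configRelabel_shift_eq_of_spinCorr_eq_plusCorr (hβ : 0 ≤ β) [IsProbabilityMeasure μp]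
    (hp : ∀ A : Finset (Site 2), spinCorr μp A = plusCorr 2 β 0 A) (v : Site 2) :
    μp.map (configRelabel (Site.shift v)) = μp := by
  haveI : IsProbabilityMeasure (μp.map (configRelabel (Site.shift v))) :=
    Measure.isProbabilityMeasure_map (configRelabel _).measurable.aemeasurable
  refine measure_eq_of_forall_spinCorr_eq _ _ fun A => ?_
  rw [spinCorr_map_configRelabel, shift_symm_eq_shift_neg, hp, hp, plusCorr_shift (d := 2) hβ le_rfl]

/-- **The plus state is invariant under the coordinate reflections** (tree:
`map_configRelabel_signedPerm_eq_of_spinCorr_eq_plusCorr`). [cite: GeorgiiHiguchi2000, §2 p. 3] -/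
theorem map_configRelabel_reflectCoord_eq_of_spinCorr_eq_plusCorr [IsProbabilityMeasure μp]
    (hp : ∀ A : Finset (Site 2), spinCorr μp A = plusCorr 2 β 0 A) (i : Fin 2) :
    μp.map (configRelabel (reflectCoord i).toEquiv) = μp := by
  rw [reflectCoord_toEquiv]
  exact map_configRelabel_signedPerm_eq_of_spinCorr_eq_plusCorr _ _ μp hp

/-- **Uniqueness of the infinite `s∗`-cluster under a `2ℤ²`-invariant tail-trivial Ising state**
(Burton–Keane for `∗`clusters, `StarBurtonKeane`, with finite energy and ergodicity under `2e₀`). [cite: GeorgiiHiguchi2000, Lemma 4.1 (uniqueness, ∗ clusters)] -/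
theorem IsGibbsMeasure.ae_starCluster_unique_of_shift_invariant {h : ℝ} {μ : Measure (SpinConfig (Site 2))}
    (hμ : μ ∈ isingGibbsMeasures 2 β h) (hμt : IsTailTrivial μ)
    (hinv : ∀ v : Site 2, μ.map (configRelabel (Site.shift ((2 : ℤ) • v))) = μ) (s : ℤˣ) :
    ∀ᵐ ω ∂μ, ∀ x y, (siteCluster zdStarGraph (spinSites s ω) x).Infinite →
      (siteCluster zdStarGraph (spinSites s ω) y).Infinite →
        (siteOpenGraph zdStarGraph (spinSites s ω)).Reachable x y := by
  have hμG : IsGibbsMeasure (isingSpecification (zdGraph 2) β h) μ := hμ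
  haveI := hμG.isProbabilityMeasure
  refine ae_starCluster_unique s hinv (fun A hA hAinv => ?_) fun N S hS hpos => ?_
  · exact IsTailTrivial.measure_eq_zero_or_one_of_shift_invariant hμt (two_smul_single_ne_zero (d := 2) (by norm_num))
      (hinv _) hA (hAinv _)
  · exact hμG.measure_ne_zero_of_glueWith (zdGraph 2) (box 2 N) (fun _ => s) hS hpos

end PlusState

/-! ### The plus-sea lemma -/

section PlusSea

variable {β : ℝ} {μp : Measure (SpinConfig (Site 2))}

/-- **Georgii–Higuchi 2000, Corollary 3.3 (Plus-sea in the plus-phase): `μ⁺(E⁻∗) = 0`.** For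
`β > β_c(2)` and `μ⁺ ∈ 𝒢(β, 0)` on `ℤ²` with the plus correlations, almost surely there is no
infinite `∗`-cluster of `-`spins. Proof (Zhang's argument, module docstring): otherwise
`μ⁺(E⁻∗) = 1` by tail triviality; with `μ⁺(E⁺) = 1`, uniqueness of both infinite clusters
(Burton–Keane), positive correlations and the reflection symmetries of `μ⁺` one finds a `+`path
and a `-∗`path inside a square between interleaved quadrant arcs, contradicting
`exists_mem_support_of_quadrant_crossing_star`. [cite: GeorgiiHiguchi2000, Cor. 3.3] -/
theorem measure_existsInfCluster_star_neg_eq_zero_of_spinCorr_eq_plusCorr (hβc : criticalBeta 2 < β)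
    (hμp : μp ∈ isingGibbsMeasures 2 β 0) (hp : ∀ A : Finset (Site 2), spinCorr μp A = plusCorr 2 β 0 A) :
    μp (existsInfCluster zdStarGraph (-1)) = 0 := by
  have hβ : 0 ≤ β := (criticalBeta_nonneg 2).trans hβc.le
  have hμG : IsGibbsMeasure (isingSpecification (zdGraph 2) β 0) μp := hμp
  haveI := hμG.isProbabilityMeasure
  have hμt : IsTailTrivial μp := isTailTrivial_of_spinCorr_eq_plusCorr hβ hμp hp
  rcases IsTailTrivial.measure_existsInfCluster (G := zdStarGraph) hμt (-1) with h0 | h1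
  · exact h0
  exfalso
  -- symmetries and uniqueness
  have hE : μp (existsInfCluster (zdGraph 2) 1) = 1 :=
    measure_existsInfCluster_one_eq_one_of_spinCorr_eq_plusCorr le_rfl hβc hμp hp
  have hshift : ∀ v : Site 2, μp.map (configRelabel (Site.shift v)) = μp :=
    map_configRelabel_shift_eq_of_spinCorr_eq_plusCorr hβ hp
  have hinv2 : ∀ v : Site 2, μp.map (configRelabel (Site.shift ((2 : ℤ) • v))) = μp := fun v => hshift _
  have hR : ∀ i : Fin 2, μp.map (configRelabel (reflectCoord i).toEquiv) = μp :=
    map_configRelabel_reflectCoord_eq_of_spinCorr_eq_plusCorr hp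
  have huniqP := IsGibbsMeasure.ae_siteCluster_unique_of_shift_invariant hμp hμt hinv2 1
  have huniqM := IsGibbsMeasure.ae_starCluster_unique_of_shift_invariant hμp hμt hinv2 (-1)
  -- squares `Λ_m ⊆ Λ_N`
  have hsupP : ∀ x y, (zdGraph 2).Adj x y → ∀ i, |x i - y i| ≤ 1 := fun x y h =>
    zdStarGraph_range_one x y (zdGraph_le_zdStarGraph h)
  obtain ⟨m, hmP, hmM⟩ := ((exists_box_meets_infiniteOf (G := zdGraph 2) 1 hE
      (by norm_num : (0 : ℝ) < (2 : ℝ)⁻¹ ^ 20)).and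
    (exists_box_meets_infiniteOf (G := zdStarGraph) (-1) h1 (by norm_num : (0 : ℝ) < (2 : ℝ)⁻¹ ^ 20))).exists
  obtain ⟨N, hNm, hNP, hNM⟩ := ((eventually_ge_atTop m).and
    ((eventually_measureReal_localUniqueOf (G := zdGraph 2) 1 m huniqP (by norm_num : (0 : ℝ) < 1 / 32)).and
      (eventually_measureReal_localUniqueOf (G := zdStarGraph) (-1) m huniqM
        (by norm_num : (0 : ℝ) < 1 / 32)))).exists
  -- the arm events
  set AP : ℤˣ × ℤˣ → Set (SpinConfig (Site 2)) := fun q => armEventOf (zdGraph 2) 1 m N (quadArc q N) with hAP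
  set AM : ℤˣ × ℤˣ → Set (SpinConfig (Site 2)) := fun q => armEventOf zdStarGraph (-1) m N (quadArc q N) with hAM
  have hAPm : ∀ q, MeasurableSet (AP q) := fun q => measurableSet_armEventOf 1 m N _
  have hAMm : ∀ q, MeasurableSet (AM q) := fun q => measurableSet_armEventOf (-1) m N _
  have hc : ∀ {S : Set (SpinConfig (Site 2))}, MeasurableSet S → μp.real Sᶜ = 1 - μp.real S := fun hS => by
    rw [measureReal_compl hS, probReal_univ]
  have hcard : (Finset.univ : Finset (ℤˣ × ℤˣ)).card = 4 := by
    rw [Finset.card_univ, Fintype.card_prod, Fintype.card_units_int]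
  -- square-root trick for the `+`arms (complements are lower sets)
  obtain ⟨qP, hqP⟩ : ∃ q : ℤˣ × ℤˣ, μp.real (AP q)ᶜ < 1 / 32 := by
    by_contra hall
    push Not at hall
    have hprod : ∏ q : ℤˣ × ℤˣ, μp.real (AP q)ᶜ ≤ μp.real (⋂ q ∈ (Finset.univ : Finset (ℤˣ × ℤˣ)), (AP q)ᶜ) :=
      prod_measureReal_le_measureReal_iInter_of_isLowerSet hβ hμp hμt Finset.univ
        (fun q => (isUpperSet_armEventOf_one m N (quadArc q N)).compl) fun q => (hAPm q).compl
    have hcov : (⋂ q ∈ (Finset.univ : Finset (ℤˣ × ℤˣ)), (AP q)ᶜ) ⊆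
        {ω | ∃ x ∈ box 2 m, (siteCluster (zdGraph 2) (spinSites 1 ω) x).Infinite}ᶜ := by
      intro ω hω hω'
      obtain ⟨q, hq⟩ := Set.mem_iUnion.1 (subset_iUnion_armEventOf hsupP 1 hNm hω')
      simp only [Set.mem_iInter, Finset.mem_univ, true_implies, Set.mem_compl_iff] at hω
      exact hω q hq
    have hmeas : MeasurableSet {ω : SpinConfig (Site 2) | ∃ x ∈ box 2 m,
        (siteCluster (zdGraph 2) (spinSites 1 ω) x).Infinite} := by
      have : {ω : SpinConfig (Site 2) | ∃ x ∈ box 2 m, (siteCluster (zdGraph 2) (spinSites 1 ω) x).Infinite} =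
          ⋃ x ∈ box 2 m, {ω | (siteCluster (zdGraph 2) (spinSites 1 ω) x).Infinite} := by
        ext ω; simp
      rw [this]
      exact Finset.measurableSet_biUnion _ fun x _ => measurableSet_infinite_siteClusterOf 1 x
    have hsmall : μp.real {ω | ∃ x ∈ box 2 m, (siteCluster (zdGraph 2) (spinSites 1 ω) x).Infinite}ᶜ <
        (2 : ℝ)⁻¹ ^ 20 := by rw [hc hmeas]; linarith
    have hge : ((1 : ℝ) / 32) ^ 4 ≤ ∏ q : ℤˣ × ℤˣ, μp.real (AP q)ᶜ := by
      calc ((1 : ℝ) / 32) ^ 4 = ∏ _q : ℤˣ × ℤˣ, ((1 : ℝ) / 32) := by rw [Finset.prod_const, hcard]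
        _ ≤ ∏ q : ℤˣ × ℤˣ, μp.real (AP q)ᶜ :=
            Finset.prod_le_prod (fun q _ => by norm_num) fun q _ => hall q
    have := (hge.trans hprod).trans (measureReal_mono hcov)
    linarith [this, hsmall, show ((1 : ℝ) / 32) ^ 4 = (2 : ℝ)⁻¹ ^ 20 by norm_num]
  -- square-root trick for the `-∗`arms (complements are upper sets)
  obtain ⟨qM, hqM⟩ : ∃ q : ℤˣ × ℤˣ, μp.real (AM q)ᶜ < 1 / 32 := by
    by_contra hall
    push Not at hall
    have hprod : ∏ q : ℤˣ × ℤˣ, μp.real (AM q)ᶜ ≤ μp.real (⋂ q ∈ (Finset.univ : Finset (ℤˣ × ℤˣ)), (AM q)ᶜ) :=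
      prod_measureReal_le_measureReal_iInter_of_isUpperSet hβ hμp hμt Finset.univ
        (fun q => (isLowerSet_armEventOf_neg_one m N (quadArc q N)).compl) fun q => (hAMm q).compl
    have hcov : (⋂ q ∈ (Finset.univ : Finset (ℤˣ × ℤˣ)), (AM q)ᶜ) ⊆
        {ω | ∃ x ∈ box 2 m, (siteCluster zdStarGraph (spinSites (-1) ω) x).Infinite}ᶜ := by
      intro ω hω hω'
      obtain ⟨q, hq⟩ := Set.mem_iUnion.1 (subset_iUnion_armEventOf zdStarGraph_range_one (-1) hNm hω')
      simp only [Set.mem_iInter, Finset.mem_univ, true_implies, Set.mem_compl_iff] at hω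
      exact hω q hq
    have hmeas : MeasurableSet {ω : SpinConfig (Site 2) | ∃ x ∈ box 2 m,
        (siteCluster zdStarGraph (spinSites (-1) ω) x).Infinite} := by
      have : {ω : SpinConfig (Site 2) | ∃ x ∈ box 2 m, (siteCluster zdStarGraph (spinSites (-1) ω) x).Infinite} =
          ⋃ x ∈ box 2 m, {ω | (siteCluster zdStarGraph (spinSites (-1) ω) x).Infinite} := by
        ext ω; simp
      rw [this]
      exact Finset.measurableSet_biUnion _ fun x _ => measurableSet_infinite_siteClusterOf (-1) x
    have hsmall : μp.real {ω | ∃ x ∈ box 2 m, (siteCluster zdStarGraph (spinSites (-1) ω) x).Infinite}ᶜ <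
        (2 : ℝ)⁻¹ ^ 20 := by rw [hc hmeas]; linarith
    have hge : ((1 : ℝ) / 32) ^ 4 ≤ ∏ q : ℤˣ × ℤˣ, μp.real (AM q)ᶜ := by
      calc ((1 : ℝ) / 32) ^ 4 = ∏ _q : ℤˣ × ℤˣ, ((1 : ℝ) / 32) := by rw [Finset.prod_const, hcard]
        _ ≤ ∏ q : ℤˣ × ℤˣ, μp.real (AM q)ᶜ :=
            Finset.prod_le_prod (fun q _ => by norm_num) fun q _ => hall q
    have := (hge.trans hprod).trans (measureReal_mono hcov)
    linarith [this, hsmall, show ((1 : ℝ) / 32) ^ 4 = (2 : ℝ)⁻¹ ^ 20 by norm_num]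
  -- reflection symmetry: all eight arm events have complement `< 1/32`
  have hRv : ∀ a b, zdStarGraph.Adj a b → zdStarGraph.Adj (reflectCoord 0 a) (reflectCoord 0 b) :=
    fun a b hab => (starReflectHom 0).map_rel hab
  have hRh : ∀ a b, zdStarGraph.Adj a b → zdStarGraph.Adj (reflectCoord 1 a) (reflectCoord 1 b) :=
    fun a b hab => (starReflectHom 1).map_rel hab
  have hRvP : ∀ a b, (zdGraph 2).Adj a b → (zdGraph 2).Adj (reflectCoord 0 a) (reflectCoord 0 b) :=
    fun a b hab => (reflectCoord 0).map_rel_iff.2 hab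
  have hRhP : ∀ a b, (zdGraph 2).Adj a b → (zdGraph 2).Adj (reflectCoord 1 a) (reflectCoord 1 b) :=
    fun a b hab => (reflectCoord 1).map_rel_iff.2 hab
  have hsymm : ∀ {G : SimpleGraph (Site 2)} [G.LocallyFinite] (i : Fin 2)
      (hG : ∀ a b, G.Adj a b → G.Adj (reflectCoord i a) (reflectCoord i b)) (s : ℤˣ) (q : ℤˣ × ℤˣ),
      μp.real (armEventOf G s m N (quadArc q N)) ≤
        μp.real (armEventOf G s m N (reflectCoord i '' quadArc q N)) := by
    intro G _ i hG s q
    have h1 : μp (armEventOf G s m N (quadArc q N)) =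
        μp (configRelabel (reflectCoord i).toEquiv ⁻¹' armEventOf G s m N (quadArc q N)) := by
      conv_lhs => rw [← hR i]
      rw [Measure.map_apply (configRelabel _).measurable (measurableSet_armEventOf s m N _)]
    simp only [measureReal_def]
    rw [h1]
    exact ENNReal.toReal_mono (measure_ne_top _ _)
      (measure_mono (preimage_configRelabel_armEventOf_subset i hG s m N _))
  have hvP : ∀ q, μp.real (AP q) ≤ μp.real (AP (-q.1, q.2)) := fun q =>
    (hsymm 0 hRvP 1 q).trans (measureReal_mono (armEventOf_mono (image_reflectCoord_zero_quadArc_subset q N)))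
  have hhP : ∀ q, μp.real (AP q) ≤ μp.real (AP (q.1, -q.2)) := fun q =>
    (hsymm 1 hRhP 1 q).trans (measureReal_mono (armEventOf_mono (image_reflectCoord_one_quadArc_subset q N)))
  have hvM : ∀ q, μp.real (AM q) ≤ μp.real (AM (-q.1, q.2)) := fun q =>
    (hsymm 0 hRv (-1) q).trans (measureReal_mono (armEventOf_mono (image_reflectCoord_zero_quadArc_subset q N)))
  have hhM : ∀ q, μp.real (AM q) ≤ μp.real (AM (q.1, -q.2)) := fun q =>
    (hsymm 1 hRh (-1) q).trans (measureReal_mono (armEventOf_mono (image_reflectCoord_one_quadArc_subset q N)))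
  -- every quadrant is reached from `qP` (resp. `qM`) by reflections
  have hallP : ∀ q : ℤˣ × ℤˣ, μp.real (AP q) > 31 / 32 := by
    have h0 : μp.real (AP qP) > 31 / 32 := by rw [hc (hAPm qP)] at hqP; linarith
    have h1 : μp.real (AP (-qP.1, qP.2)) > 31 / 32 := lt_of_lt_of_le h0 (hvP qP)
    have h2 : μp.real (AP (qP.1, -qP.2)) > 31 / 32 := lt_of_lt_of_le h0 (hhP qP)
    have h3 : μp.real (AP (-qP.1, -qP.2)) > 31 / 32 := by
      have := hhP (-qP.1, qP.2); exact lt_of_lt_of_le h1 this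
    intro q
    obtain ⟨q₁, q₂⟩ := q
    obtain ⟨p₁, p₂⟩ := qP
    rcases Int.units_eq_one_or q₁ with rfl | rfl <;> rcases Int.units_eq_one_or q₂ with rfl | rfl <;>
      rcases Int.units_eq_one_or p₁ with rfl | rfl <;> rcases Int.units_eq_one_or p₂ with rfl | rfl <;>
      simp only [neg_neg] at h0 h1 h2 h3 ⊢ <;> first | exact h0 | exact h1 | exact h2 | exact h3
  have hallM : ∀ q : ℤˣ × ℤˣ, μp.real (AM q) > 31 / 32 := by
    have h0 : μp.real (AM qM) > 31 / 32 := by rw [hc (hAMm qM)] at hqM; linarith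
    have h1 : μp.real (AM (-qM.1, qM.2)) > 31 / 32 := lt_of_lt_of_le h0 (hvM qM)
    have h2 : μp.real (AM (qM.1, -qM.2)) > 31 / 32 := lt_of_lt_of_le h0 (hhM qM)
    have h3 : μp.real (AM (-qM.1, -qM.2)) > 31 / 32 := by
      have := hhM (-qM.1, qM.2); exact lt_of_lt_of_le h1 this
    intro q
    obtain ⟨q₁, q₂⟩ := q
    obtain ⟨p₁, p₂⟩ := qM
    rcases Int.units_eq_one_or q₁ with rfl | rfl <;> rcases Int.units_eq_one_or q₂ with rfl | rfl <;>
      rcases Int.units_eq_one_or p₁ with rfl | rfl <;> rcases Int.units_eq_one_or p₂ with rfl | rfl <;>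
      simp only [neg_neg] at h0 h1 h2 h3 ⊢ <;> first | exact h0 | exact h1 | exact h2 | exact h3
  -- union bound
  set Good : Set (SpinConfig (Site 2)) := AP (1, 1) ∩ AP (-1, -1) ∩ AM (-1, 1) ∩ AM (1, -1) ∩
    localUniqueOf (zdGraph 2) 1 m N ∩ localUniqueOf zdStarGraph (-1) m N with hGood
  have hU1 := measurableSet_localUniqueOf (G := zdGraph 2) 1 m N
  have hU2 := measurableSet_localUniqueOf (G := zdStarGraph) (-1) m N
  have hGood_pos : 0 < μp.real Good := by
    have hsub : Goodᶜ ⊆ (AP (1, 1))ᶜ ∪ (AP (-1, -1))ᶜ ∪ (AM (-1, 1))ᶜ ∪ (AM (1, -1))ᶜ ∪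
        (localUniqueOf (zdGraph 2) 1 m N)ᶜ ∪ (localUniqueOf zdStarGraph (-1) m N)ᶜ := by
      intro ω hω
      simp only [hGood, Set.mem_compl_iff, Set.mem_inter_iff, not_and_or] at hω
      simp only [Set.mem_union, Set.mem_compl_iff]
      tauto
    have u2 := measureReal_union_le (μ := μp) (AP (1, 1))ᶜ (AP (-1, -1))ᶜ
    have u3 := measureReal_union_le (μ := μp) ((AP (1, 1))ᶜ ∪ (AP (-1, -1))ᶜ) (AM (-1, 1))ᶜ
    have u4 := measureReal_union_le (μ := μp) ((AP (1, 1))ᶜ ∪ (AP (-1, -1))ᶜ ∪ (AM (-1, 1))ᶜ) (AM (1, -1))ᶜ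
    have u5 := measureReal_union_le (μ := μp)
      ((AP (1, 1))ᶜ ∪ (AP (-1, -1))ᶜ ∪ (AM (-1, 1))ᶜ ∪ (AM (1, -1))ᶜ) (localUniqueOf (zdGraph 2) 1 m N)ᶜ
    have u6 := measureReal_union_le (μ := μp)
      ((AP (1, 1))ᶜ ∪ (AP (-1, -1))ᶜ ∪ (AM (-1, 1))ᶜ ∪ (AM (1, -1))ᶜ ∪ (localUniqueOf (zdGraph 2) 1 m N)ᶜ)
      (localUniqueOf zdStarGraph (-1) m N)ᶜ
    have a1 : μp.real (AP (1, 1))ᶜ < 1 / 32 := by rw [hc (hAPm _)]; linarith [hallP (1, 1)]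
    have a2 : μp.real (AP (-1, -1))ᶜ < 1 / 32 := by rw [hc (hAPm _)]; linarith [hallP (-1, -1)]
    have a3 : μp.real (AM (-1, 1))ᶜ < 1 / 32 := by rw [hc (hAMm _)]; linarith [hallM (-1, 1)]
    have a4 : μp.real (AM (1, -1))ᶜ < 1 / 32 := by rw [hc (hAMm _)]; linarith [hallM (1, -1)]
    have a5 : μp.real (localUniqueOf (zdGraph 2) 1 m N)ᶜ < 1 / 32 := by rw [hc hU1]; linarith
    have a6 : μp.real (localUniqueOf zdStarGraph (-1) m N)ᶜ < 1 / 32 := by rw [hc hU2]; linarith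
    have hGm : MeasurableSet Good := by
      rw [hGood]
      exact (((((hAPm _).inter (hAPm _)).inter (hAMm _)).inter (hAMm _)).inter hU1).inter hU2
    have := measureReal_mono (μ := μp) hsub
    rw [hc hGm] at this
    linarith
  obtain ⟨ω, hω⟩ : Good.Nonempty :=
    nonempty_of_measure_ne_zero (by
      intro h0
      rw [measureReal_def, h0, ENNReal.toReal_zero] at hGood_pos
      exact lt_irrefl _ hGood_pos)
  -- the endgame: a `+`path `∂₁ → ∂₃` and a `-∗`path `∂₂ → ∂₄` inside `Λ_N`
  obtain ⟨⟨⟨⟨⟨hA1, hA3⟩, hA2⟩, hA4⟩, hUP⟩, hUM⟩ := hω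
  obtain ⟨x₁, hx₁, hinf₁, e₁, he₁, hc₁⟩ := hA1
  obtain ⟨x₃, hx₃, hinf₃, e₃, he₃, hc₃⟩ := hA3
  obtain ⟨x₂, hx₂, hinf₂, e₂, he₂, hc₂⟩ := hA2
  obtain ⟨x₄, hx₄, hinf₄, e₄, he₄, hc₄⟩ := hA4
  have hP : boxConnOf (zdGraph 2) 1 N ω e₁ e₃ := (hc₁.symm.trans (hUP x₁ hx₁ x₃ hx₃ hinf₁ hinf₃)).trans hc₃
  have hQ : boxConnOf zdStarGraph (-1) N ω e₂ e₄ := (hc₂.symm.trans (hUM x₂ hx₂ x₄ hx₄ hinf₂ hinf₄)).trans hc₄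
  have he₁S : e₁ ∈ spinSites 1 ω ∩ ↑(box 2 N) :=
    mem_of_boxConnOf hc₁ ⟨mem_spinSites_of_infiniteOf hinf₁, Finset.mem_coe.2 (box_mono 2 hNm hx₁)⟩
  have he₂S : e₂ ∈ spinSites (-1) ω ∩ ↑(box 2 N) :=
    mem_of_boxConnOf hc₂ ⟨mem_spinSites_of_infiniteOf hinf₂, Finset.mem_coe.2 (box_mono 2 hNm hx₂)⟩
  obtain ⟨P⟩ := hP
  obtain ⟨Q⟩ := hQ
  have hleP : siteOpenGraph (zdGraph 2) (spinSites 1 ω ∩ ↑(box 2 N)) ≤ zdGraph 2 := fun a b hab =>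
    ((siteOpenGraph_adj _ _ _ _).1 hab).1
  have hleQ : siteOpenGraph zdStarGraph (spinSites (-1) ω ∩ ↑(box 2 N)) ≤ zdStarGraph := fun a b hab =>
    ((siteOpenGraph_adj _ _ _ _).1 hab).1
  have hPs : ∀ z ∈ (P.mapLe hleP).support, z ∈ spinSites 1 ω ∩ ↑(box 2 N) := fun z hz => by
    rw [Walk.support_mapLe_eq_support] at hz
    exact support_subset_of_walk_siteOpenGraph P he₁S z hz
  have hQs : ∀ z ∈ (Q.mapLe hleQ).support, z ∈ spinSites (-1) ω ∩ ↑(box 2 N) := fun z hz => by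
    rw [Walk.support_mapLe_eq_support] at hz
    exact support_subset_of_walk_siteOpenGraph Q he₂S z hz
  obtain ⟨z, hzP, hzQ⟩ := exists_mem_support_of_quadrant_crossing_star (N := N) (P.mapLe hleP) (Q.mapLe hleQ)
    (fun z hz => mem_box.1 (Finset.mem_coe.1 (hPs z hz).2))
    (fun z hz => mem_box.1 (Finset.mem_coe.1 (hQs z hz).2))
    (quadArc_one_one he₁) (quadArc_neg_one he₂) (quadArc_neg_neg he₃) (quadArc_one_neg he₄)
  have h1' : ω z = 1 := (hPs z hzP).1
  have h2' : ω z = -1 := (hQs z hzQ).1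
  rw [h1'] at h2'
  exact absurd h2' (by decide)

end PlusSea

end Literature.Probability.LatticeModels
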